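/-
Origin: expansion seat `prover-pub-hodgecm-mc-sinst-1-g3-0`, handover #1211 2026-08-20T05:09Z md5 e51fff78602c (146 l.) NEW additive drop-alone leaf after #1208 AND theta-3 (T) Model/ArchLineDatumTotal (cross-kit rowdep); lineCT twin: archLineDatumTotalReadOff (= (T) with hμ₀ discharged, hμ₁₂₃ := Δ-identities); drop alone on bounce (and with #1207/#1208 or (T)); NAME LIST: HodgeCM.Model.ArchSideTerm.archLineDatumTotalReadOff · HodgeCM.Model.ArchSideTerm.continuous_lineCTHom · HodgeCM.Model.ArchSideTerm.lineCTHom_apply) (`HOME/mc/pub-hodgecm-mc-sinst-1-g3/stage/HodgeCM/Model/ArchLineSlotTypeTotal.lean`, md5 e51fff78602c, 146 lines);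
landed by the gen-15 packager (p-g15) in gate run 41 as `HodgeCM/Model/ArchLineSlotTypeTotal.lean` (verbatim).
-/
/-
Origin: speedrun cell pub-hodgecm, MODEL-CONSTRUCTION sub-cell, lineage mc-sinst-1 (S-instance constructor, BINDER-OWNERS row 5 `S`),
seat prover-pub-hodgecm-mc-sinst-1-g3-0 (gen 3), 2026-08-20.  Target in PKG: `HodgeCM/Model/ArchLineSlotTypeTotal.lean`
(NEW additive drop-alone leaf; imports `Model/ArchLineSlotTypeCont` (sinst-1 #1208) and theta-3's (T) `Model/ArchLineDatumTotal` (RUN-41 row)).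
KERNEL only: 0 records / `def … : Prop` / cites, 0 proof holes; intended closure {propext, Classical.choice, Quot.sound}.
-/
import Summits.HodgeConjecture.HodgeCM.Model.ArchLineSlotTypeCont_2
import Summits.HodgeConjecture.HodgeCM.Model.ArchLineDatumTotal_2

/-!
# The (J-μ) read-off at theta-3's TOTAL datum (T): `lineCT` as a hom, its continuity, and `archLineDatumTotal` fed by the read-off

(T) `archLineDatumTotal … (hμ₀ hμ₁ hμ₂ hμ₃)` states its four (J-μ) inputs over the TOTAL eigenvalue `lineCT` (degree-one branch `lineC`,
vacuum branch `vacC = lineCenterChar`).  This leaf is the `lineCT` twin of `ArchLineSlotTypeCont` §2–§3: `lineCTHom` (a `MonoidHom` whose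
application IS `lineCT`, definitionally), `continuous_lineCTHom`, `continuous_slotChiₖ_mul_lineCTHom (h₁W)`, `slotTypeTVec`, and
**`archLineDatumTotalReadOff`** = (T) with `hμ₀` DISCHARGED by the slot-0 normalisation and `hμ₁₂₃` fed by the three integer identities
`slotTypeTVec k − slotTypeTVec 0 = μ k − μ 0` — under plane-definiteness `h₁W` (any good context), for any recipe bit / orientation.
Nothing here is a claim of PerL/QW8; nothing is cited as a fact.
-/

set_option autoImplicit false

noncomputable section

open scoped Matrix Classical
open Literature.NumberTheory.Automorphic Literature.NumberTheory.Weil1964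
open Literature.NumberTheory.GelbartRogawski1991.UnitaryDualPair
open HodgeCM.Adelic HodgeCM.PerL34

namespace HodgeCM.Model.ArchSideTerm

section LineCT

variable {L : CMField} {ι₁ : L →+* ℂ} (V : HermSpace3 L ι₁)
variable (d : (L : Type)) (hd : NumberField.IsCMField.complexConj L d = d) (hd0 : d ≠ 0)
  (hGRd : (cmSplittingDatum (L : Type) (e₁) (frameD V) (frameD_real V) (frameD_ne V) (lineVec (L : Type) d) (fun _ => hd)
    (fun _ => hd0)).CompatibleSplitting)

/-- **(T)'s total centre eigenvalue `lineCT` as a homomorphism** (application is `lineCT`, definitionally). -/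
def lineCTHom : ↥(relNormOneInfUnits (↥(NumberField.maximalRealSubfield (L : Type))) (L : Type)) →* ℂ where
  toFun := lineCT V d hd hd0 hGRd
  map_one' := by
    by_cases h : 0 < HypCensus.cmXW (L : Type) (frameD V) (lineVec (L : Type) d) (fun _ => hd) ι₁ (HypCensus.cmPlace (L : Type) ι₁) 0
    · rw [lineCT_of_pos h, ← lineCHom_apply, map_one]
    · rw [lineCT_of_not_pos h, vacC_def, map_one, Circle.coe_one]
  map_mul' a b := by
    by_cases h : 0 < HypCensus.cmXW (L : Type) (frameD V) (lineVec (L : Type) d) (fun _ => hd) ι₁ (HypCensus.cmPlace (L : Type) ι₁) 0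
    · rw [lineCT_of_pos h, lineCT_of_pos h, lineCT_of_pos h, ← lineCHom_apply, ← lineCHom_apply,
        ← lineCHom_apply, map_mul]
    · rw [lineCT_of_not_pos h, lineCT_of_not_pos h, lineCT_of_not_pos h, vacC_def, vacC_def, vacC_def,
        map_mul, Circle.coe_mul]

/-- `lineCTHom … t = lineCT … t` (definitional). -/
theorem lineCTHom_apply (t : ↥(relNormOneInfUnits (↥(NumberField.maximalRealSubfield (L : Type))) (L : Type))) : lineCTHom V d hd hd0 hGRd t = lineCT V d hd hd0 hGRd t := rfl

/-- `lineCTHom` is continuous (both branches are continuous characters). -/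
theorem continuous_lineCTHom : Continuous (lineCTHom V d hd hd0 hGRd) := by
  by_cases h : 0 < HypCensus.cmXW (L : Type) (frameD V) (lineVec (L : Type) d) (fun _ => hd) ι₁ (HypCensus.cmPlace (L : Type) ι₁) 0
  · have : ⇑(lineCTHom V d hd hd0 hGRd) = ⇑(lineCHom V d hd hd0 hGRd) := funext fun t => lineCT_of_pos h t
    rw [this]
    exact continuous_lineCHom V d hd hd0 hGRd
  · have : ⇑(lineCTHom V d hd hd0 hGRd) = fun t => ((lineCenterChar V d hd hd0 hGRd t : Circle) : ℂ) :=
      funext fun t => lineCT_of_not_pos h t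
    rw [this]
    exact continuous_subtype_val.comp (continuous_lineCenterChar V d hd hd0 hGRd)

end LineCT

section Assembly

variable
  (χV χW : ∀ {L : CMField} {ι₁ : L →+* ℂ} (_V : HermSpace3 L ι₁) (_c : SeesawCtx L),
    ContinuousMonoidHom (relNormOneIdeles (↥(NumberField.maximalRealSubfield (L : Type))) (L : Type) ⧸
      relNormOneRat (↥(NumberField.maximalRealSubfield (L : Type))) (L : Type)) Circle)
variable {L : CMField} {ι₁ : L →+* ℂ} (V : HermSpace3 L ι₁) (c : SeesawCtx L)
variable
  (hGR : (cmSplittingDatum (L : Type) finProdFinEquiv (frameD V) (frameD_real V) (frameD_ne V) (dW c.D) (dW_real c.D) (dW_ne c.D)).CompatibleSplitting)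
  (hGR₀ : (cmSplittingDatum (L : Type) (e₁) (frameD V) (frameD_real V) (frameD_ne V) (lineVec (L : Type) (dW c.D 0))
    (fun _ => dW_real c.D 0) (fun _ => dW_ne c.D 0)).CompatibleSplitting)
  (hGR₁ : (cmSplittingDatum (L : Type) (e₁) (frameD V) (frameD_real V) (frameD_ne V) (lineVec (L : Type) (dW c.D 1))
    (fun _ => dW_real c.D 1) (fun _ => dW_ne c.D 1)).CompatibleSplitting)
  (hGR₂ : (cmSplittingDatum (L : Type) (e₁) (frameD V) (frameD_real V) (frameD_ne V) (lineVec (L : Type) (dW' c.D 0))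
    (fun _ => dW'_real c.D 0) (fun _ => dW'_ne c.D 0)).CompatibleSplitting)
  (hGR₃ : (cmSplittingDatum (L : Type) (e₁) (frameD V) (frameD_real V) (frameD_ne V) (lineVec (L : Type) (dW' c.D 1))
    (fun _ => dW'_real c.D 1) (fun _ => dW'_ne c.D 1)).CompatibleSplitting)
  (μ : Fin 4 → NumberField.InfinitePlace (L : Type) → ℤ)
  (h₁W : (∀ j, 0 < (ι₁ (dW c.D j)).re) ∨ ∀ j, (ι₁ (dW c.D j)).re < 0)

include h₁W in
/-- (Ported verbatim from the HodgeCMPerL package; no docstring in the source.) -/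
theorem continuous_slotChi₀_mul_lineCTHom :
    Continuous ⇑(slotChi₀ V c.D hGR hGR₀ hGR₁ * lineCTHom V (dW c.D 0) (dW_real c.D 0) (dW_ne c.D 0) hGR₀) :=
  (continuous_slotChi₀ V c.D hGR hGR₀ hGR₁ h₁W).mul (continuous_lineCTHom V (dW c.D 0) (dW_real c.D 0) (dW_ne c.D 0) hGR₀)

include h₁W in
/-- (Ported verbatim from the HodgeCMPerL package; no docstring in the source.) -/
theorem continuous_slotChi₁_mul_lineCTHom :
    Continuous ⇑(slotChi₁ V c.D hGR hGR₀ hGR₁ * lineCTHom V (dW c.D 1) (dW_real c.D 1) (dW_ne c.D 1) hGR₁) :=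
  (continuous_slotChi₁ V c.D hGR hGR₀ hGR₁ h₁W).mul (continuous_lineCTHom V (dW c.D 1) (dW_real c.D 1) (dW_ne c.D 1) hGR₁)

include h₁W in
/-- (Ported verbatim from the HodgeCMPerL package; no docstring in the source.) -/
theorem continuous_slotChi₂_mul_lineCTHom :
    Continuous ⇑(slotChi₂ V c.D hGR hGR₂ hGR₃ * lineCTHom V (dW' c.D 0) (dW'_real c.D 0) (dW'_ne c.D 0) hGR₂) :=
  (continuous_slotChi₂ V c.D hGR hGR₂ hGR₃ h₁W).mul (continuous_lineCTHom V (dW' c.D 0) (dW'_real c.D 0) (dW'_ne c.D 0) hGR₂)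

include h₁W in
/-- (Ported verbatim from the HodgeCMPerL package; no docstring in the source.) -/
theorem continuous_slotChi₃_mul_lineCTHom :
    Continuous ⇑(slotChi₃ V c.D hGR hGR₂ hGR₃ * lineCTHom V (dW' c.D 1) (dW'_real c.D 1) (dW'_ne c.D 1) hGR₃) :=
  (continuous_slotChi₃ V c.D hGR hGR₂ hGR₃ h₁W).mul (continuous_lineCTHom V (dW' c.D 1) (dW'_real c.D 1) (dW'_ne c.D 1) hGR₃)

/-- the four slot types at (T)'s TOTAL eigenvalues, as DATA (plane `dW` definite at `ι₁`). -/
def slotTypeTVec : Fin 4 → NumberField.InfinitePlace (L : Type) → ℤ :=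
  ![slotType (L := L) _ (continuous_slotChi₀_mul_lineCTHom V c hGR hGR₀ hGR₁ h₁W),
    slotType (L := L) _ (continuous_slotChi₁_mul_lineCTHom V c hGR hGR₀ hGR₁ h₁W),
    slotType (L := L) _ (continuous_slotChi₂_mul_lineCTHom V c hGR hGR₂ hGR₃ h₁W),
    slotType (L := L) _ (continuous_slotChi₃_mul_lineCTHom V c hGR hGR₂ hGR₃ h₁W)]

/-- **(T) WITH (J-μ) IN READ-OFF FORM**: theta-3's `archLineDatumTotal` at the Stage-B η, `hμ₀` discharged by the slot-0 normalisation
`hW : archType (χW V c) = μ 0 − slotTypeTVec 0`, `hμ₁₂₃` fed by the three integer identities `slotTypeTVec k − slotTypeTVec 0 = μ k − μ 0`. -/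
def archLineDatumTotalReadOff
    (hW : UnitaryLineChar.archType (L : Type) (χW V c) = μ 0 - slotTypeTVec V c hGR hGR₀ hGR₁ hGR₂ hGR₃ h₁W 0)
    (hΔ₁ : slotTypeTVec V c hGR hGR₀ hGR₁ hGR₂ hGR₃ h₁W 1 - slotTypeTVec V c hGR hGR₀ hGR₁ hGR₂ hGR₃ h₁W 0 = μ 1 - μ 0)
    (hΔ₂ : slotTypeTVec V c hGR hGR₀ hGR₁ hGR₂ hGR₃ h₁W 2 - slotTypeTVec V c hGR hGR₀ hGR₁ hGR₂ hGR₃ h₁W 0 = μ 2 - μ 0)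
    (hΔ₃ : slotTypeTVec V c hGR hGR₀ hGR₁ hGR₂ hGR₃ h₁W 3 - slotTypeTVec V c hGR hGR₀ hGR₁ hGR₂ hGR₃ h₁W 0 = μ 3 - μ 0) :
    ArchLineDatum V c.D hGR hGR₀ hGR₁ hGR₂ hGR₃ (EtaChi.η @χV @χW V c) μ :=
  archLineDatumTotal V c.D hGR hGR₀ hGR₁ hGR₂ hGR₃ (EtaChi.η @χV @χW V c) μ
    (hμ₀_of_archType_eq χV χW V c hGR hGR₀ hGR₁ _ (continuous_slotChi₀_mul_lineCTHom V c hGR hGR₀ hGR₁ h₁W) μ hW)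
    ((hμ₁_iff_sub χV χW V c hGR hGR₀ hGR₁ _ _ (continuous_slotChi₀_mul_lineCTHom V c hGR hGR₀ hGR₁ h₁W)
      (continuous_slotChi₁_mul_lineCTHom V c hGR hGR₀ hGR₁ h₁W) μ hW).2 hΔ₁)
    ((hμ₂_iff_sub χV χW V c hGR hGR₀ hGR₁ hGR₂ hGR₃ _ _ (continuous_slotChi₀_mul_lineCTHom V c hGR hGR₀ hGR₁ h₁W)
      (continuous_slotChi₂_mul_lineCTHom V c hGR hGR₂ hGR₃ h₁W) μ hW).2 hΔ₂)
    ((hμ₃_iff_sub χV χW V c hGR hGR₀ hGR₁ hGR₂ hGR₃ _ _ (continuous_slotChi₀_mul_lineCTHom V c hGR hGR₀ hGR₁ h₁W)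
      (continuous_slotChi₃_mul_lineCTHom V c hGR hGR₂ hGR₃ h₁W) μ hW).2 hΔ₃)

/-- the read-off total datum IS (T)'s datum (same `Φinf`). -/
theorem archLineDatumTotalReadOff_Φinf
    (hW : UnitaryLineChar.archType (L : Type) (χW V c) = μ 0 - slotTypeTVec V c hGR hGR₀ hGR₁ hGR₂ hGR₃ h₁W 0)
    (hΔ₁ : slotTypeTVec V c hGR hGR₀ hGR₁ hGR₂ hGR₃ h₁W 1 - slotTypeTVec V c hGR hGR₀ hGR₁ hGR₂ hGR₃ h₁W 0 = μ 1 - μ 0)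
    (hΔ₂ : slotTypeTVec V c hGR hGR₀ hGR₁ hGR₂ hGR₃ h₁W 2 - slotTypeTVec V c hGR hGR₀ hGR₁ hGR₂ hGR₃ h₁W 0 = μ 2 - μ 0)
    (hΔ₃ : slotTypeTVec V c hGR hGR₀ hGR₁ hGR₂ hGR₃ h₁W 3 - slotTypeTVec V c hGR hGR₀ hGR₁ hGR₂ hGR₃ h₁W 0 = μ 3 - μ 0) :
    (archLineDatumTotalReadOff χV χW V c hGR hGR₀ hGR₁ hGR₂ hGR₃ μ h₁W hW hΔ₁ hΔ₂ hΔ₃).Φinf = linePhiTVec V c.D :=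
  rfl

end Assembly

end HodgeCM.Model.ArchSideTerm

end
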